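import Literature.MathematicalPhysics.QuantumFieldTheory.Balaban1983to89.T4Assembly
import Literature.MathematicalPhysics.QuantumFieldTheory.Balaban1983to89.T4HybridMatching

/-!
# NE7PairwiseCauchy — row NE7 (node U5), route «PAIR-CAUCHY» (rate-free): node U6's `GenFunCauchy` (hence node U0)
# from a PAIRWISE two-run comparison with a remainder that only TENDS TO ZERO — no `Σ_K δ_K < ∞`, no geometric rate

Cell `pub-balaban`, rung (B)+1 sub-cell t4, lineage `b2b-balaban-t4-ne7-p2` (CRUX PROVER NE7 #2 under the coordinator
ruling «YM redirect», 2026-08-21; generation 48; route text `HOME/t4/b2b-balaban-t4-ne7-p2/g48/ROUTE2-NE7-P2.md`).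
HONEST FRAMING (page 1): FIXED FINITE T⁴, rung (B)+1 = existence AND uniqueness of the `ε = L^{−K} → 0` limit of
unit-scale averaged expectations, CONDITIONAL on BetaPertH and the nine spine estimates (0/9 proved); NOT infinite
volume, NOT a mass gap, NOT the Clay problem.  NE7 is NOT PRINTED in [Balaban1984PropagatorsI]–[Balaban1989LargeFieldII]
and NOT proved here.  Everything below is [folklore] real analysis on HYPOTHESIS SHAPES (abstract families of reals);
no definition, no cite tag, nothing printed asserted, no `sorry`.

WHY (the route in three sentences).  Node U5 is typed CONSECUTIVELY — `T4CauchySum.MatchingModConstants vol l₀ δ Z`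
compares the runs of `K` and `K+1` steps and node U6 (`cauchySeq_genFun`) needs `Summable δ`; every road of the row
(P1 term-wise, P3 weight, P4 law-level) therefore asks the other rows for GEOMETRIC two-run rates `θ^{age}` and for
SUMMABLE bad-class weights, and the row's wall is that print supplies one-run SIZES, which «do not sum»
(`HOME/t4/ideate/NE7-WALL.md` §1).  But node U0 consumes only `T4Assembly.GenFunCauchy` (a Cauchy sequence per string
and source strength), and a Cauchy sequence needs NO summable consecutive remainder: if the runs of `K` and `K′ ≥ K`
steps are compared DIRECTLY (synchronised on the coarser run's labels, the `K′ − K` unmatched top steps resummed —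
node U5a's transport iterated), a remainder `vol·D K` with merely `D K → 0` gives `CauchySeq` (§1); the hybrid
good∕bad-class algebra of `T4HybridMatching.HybridSandwich` is ALREADY pairwise, so bad-class weights need only
`W K → 0` (§2); and the remainder of a pair is a CROSSOVER SUM `Σ_{m ≤ K} min (S m) (ω (K − m))` of ONE-RUN SIZES
`S m` of the terms born at block scale `m` (summable over `m` — the printed type: `E₀·a^m`, `R₁·g_m^{κ₀}`, …) against
TWO-RUN MODULI `ω(age)` that only TEND TO ZERO with the age `K − m` of the block scale — and such a sum tends to zero
by Tannery's theorem (dominated convergence for series), with NO rate on `ω` and NO summability in `K` (§3).  So on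
this route every two-run ask of rows NE2∕NE3∕NE5∕NE9∕U2 is asked in its QUALITATIVE form («→ 0 with the age»), rows
NE7b∕NE7c are asked for `W K → 0`, `Wsh K → 0` instead of summability, and road P1's window∕crossover∕(0.31)
summability bookkeeping is not needed; the price is that NO RATE of convergence of the continuum limit is obtained and
node U5 AS TYPED (summable `δ`) is bypassed, not proved.  (The WALL's dichotomy «a rate, or an identification
principle» — §3 item 9, and `rg-contraction` (11.5)(i) «telescoping would give only δ_K → 0, not Cauchy» — concerns
CONSECUTIVE telescoping and LIMITING maps; the pairwise comparison is neither.)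

WHAT IS PROVED ([folklore]).
§1 `abs_genFun_sub_genFun_le_of_pair` (a pair bound `|log Z_{K′}(t) − log Z_K(t) − c| ≤ vol·D K` for `|t| ≤ l₀`
   gives `|genFun Z K′ t − genFun Z K t| ≤ 2·vol·D K` — the constant cancels against `t = 0`);
   **`cauchySeq_genFun_of_pairMatching`** (`D → 0` ⟹ `CauchySeq (K ↦ genFun Z K t)`), `cauchy_uniform_of_pairMatching`
   (uniformly in `|t| ≤ l₀`); by-name exits **`genFunCauchy_of_pairMatching`** (node U6's `T4Assembly.GenFunCauchy S l₀`)
   and **`hasContinuumLimit_of_pairMatching`** ∕ `limitPointsAgree_of_pairMatching` (node U0's targets, through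
   `T4Assembly.hasContinuumLimit_of_genFunCauchy` ∕ `limitPointsAgree_of_genFunCauchy`).
§2 **`pairMatching_of_hybridSandwich`** — per pair `K ≤ K′` a `HybridSandwich (T K) (G K K′ t) (A K t) (B K K′ t) c (vol·D K) (W K)`
   (run `K′` fibre-summed onto run `K`'s labels; ONE CALL of `HybridSandwich.abs_log_sum_sub_le`) and the E1∕E2
   dictionary give the pair bound with remainder `vol·hybridDelta vol D W K = vol·D K − log(1 − W K)`;
   `tendsto_hybridDelta_zero` (`D → 0`, `W → 0`, `W < 1` ⟹ `hybridDelta vol D W → 0`);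
   **`genFunCauchy_of_pairHybrid`** (the two composed: node U6 from a pairwise hybrid with VANISHING, not summable, data).
§3 **`tendsto_sum_min_size_modulus`** — `0 ≤ S` summable, `0 ≤ ω → 0` ⟹ `Σ_{m ≤ K} min (S m) (ω (K − m)) → 0`
   (Tannery, `tendsto_tsum_of_dominated_convergence`); `sum_min_size_modulus_le_split` (the elementary two-piece bound
   `≤ Σ_{m ≤ M} ω (K − m) + Σ_{M < m ≤ K} S m` behind it, for the record); `tendsto_onesided_tail` ∕ `sum_unmatched_le_tail`
   (the ONE-SIDED kind: the `K′ − K` unmatched top steps cost at most the tail `Σ_{m > K} S m → 0`, uniformly in `K′`).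
§4 `not_cauchySeq_of_harmonic_steps` — the CONTRAST: consecutive remainders `δ K = 1∕(K+1) → 0` do NOT give a Cauchy
   sequence (partial harmonic sums), so «→ 0» is enough ONLY in the pairwise organisation of §1.

NOT DELIVERED: any instance for Bałaban's runs (NODE O); the pairwise END of road P1's ledger (the 93-binder END
`TermwiseLocal.goodClause_summable_UN_levels_of_thm1At` restated with moduli for pairs — next file of this route); the
qualitative two-run moduli themselves (rows NE2∕NE3∕NE5∕NE9∕U2, un-printed in ANY form).  NOT NE7 (spine 0/9
unchanged), NOT summit progress.  HONEST DEPENDENCY: continuum YM on T⁴ ⇐ BetaPertH ∧ nine spine estimates (0/9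
proved); BetaPertH ⇐ (D1) ∧ (D4) ∧ CAP+tail; G-an2-4 gates asym, D1 and NE2/3/4.
-/

noncomputable section

open Finset Filter Topology
open scoped BigOperators

namespace Summit.QuantumFields.BalabanUV.T4Continuum.NE7PairwiseCauchy

open Literature.MathematicalPhysics.QuantumFieldTheory
open Literature.MathematicalPhysics.QuantumFieldTheory.Balaban1983to89
open T4CauchySum (genFun)
open T4HybridMatching (HybridSandwich hybridDelta)

/-! ## §1 A pairwise comparison with vanishing remainder gives Cauchy generating functions -/

section Pair

variable {vol l₀ : ℝ} {D : ℕ → ℝ} {Z : ℕ → ℝ → ℝ}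

/-- **THE PAIR BOUND ON GENERATING FUNCTIONS.**  If the runs of `K` and `K′` steps match modulo a `t`-independent
constant with remainder `vol·D K` on `|t| ≤ l₀` (and `0 ≤ l₀`), then `|genFun Z K′ t − genFun Z K t| ≤ 2·vol·D K`:
the constant cancels between `t` and `0`. [folklore] -/
theorem abs_genFun_sub_genFun_le_of_pair (hl₀ : 0 ≤ l₀) {K K' : ℕ} {c : ℝ}
    (hc : ∀ t : ℝ, |t| ≤ l₀ → |Real.log (Z K' t) - Real.log (Z K t) - c| ≤ vol * D K) {t : ℝ} (ht : |t| ≤ l₀) :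
    |genFun Z K' t - genFun Z K t| ≤ 2 * (vol * D K) := by
  have h1 := hc t ht
  have h0 := hc 0 (by simpa using hl₀)
  unfold genFun
  have e : Real.log (Z K' t) - Real.log (Z K' 0) - (Real.log (Z K t) - Real.log (Z K 0))
      = (Real.log (Z K' t) - Real.log (Z K t) - c) - (Real.log (Z K' 0) - Real.log (Z K 0) - c) := by ring
  rw [e]
  have tri := abs_sub_le (Real.log (Z K' t) - Real.log (Z K t) - c) 0 (Real.log (Z K' 0) - Real.log (Z K 0) - c)
  simp only [sub_zero, zero_sub, abs_neg] at tri
  linarith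

/-- **PAIR MATCHING WITH VANISHING REMAINDER ⟹ CAUCHY.**  If for all `K ≤ K′` the two runs match modulo a constant with
remainder `vol·D K`, `|t| ≤ l₀`, and `D K → 0`, then each `K ↦ genFun Z K t` is a Cauchy sequence — NO summability of
anything is used. [folklore] -/
theorem cauchySeq_genFun_of_pairMatching (hl₀ : 0 ≤ l₀)
    (h : ∀ K K' : ℕ, K ≤ K' → ∃ c : ℝ, ∀ t : ℝ, |t| ≤ l₀ → |Real.log (Z K' t) - Real.log (Z K t) - c| ≤ vol * D K)
    (hD : Tendsto D atTop (𝓝 0)) {t : ℝ} (ht : |t| ≤ l₀) : CauchySeq fun K => genFun Z K t := by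
  refine Metric.cauchySeq_iff'.2 fun ε hε => ?_
  have h2 : Tendsto (fun K => 2 * (vol * D K)) atTop (𝓝 0) := by
    simpa using (hD.const_mul vol).const_mul 2
  obtain ⟨N, hN⟩ := (Metric.tendsto_atTop.1 h2) ε hε
  refine ⟨N, fun n hn => ?_⟩
  obtain ⟨c, hc⟩ := h N n hn
  have hb := abs_genFun_sub_genFun_le_of_pair hl₀ hc ht
  have hNN := hN N le_rfl
  rw [Real.dist_eq, sub_zero] at hNN
  rw [Real.dist_eq]
  exact lt_of_le_of_lt (hb.trans (le_abs_self _)) hNN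

/-- The same, UNIFORMLY in `|t| ≤ l₀`: for every `ε > 0` there is `N` with `|genFun Z K′ t − genFun Z K t| < ε` for all
`N ≤ K ≤ K′` and all `|t| ≤ l₀` (the remainder does not see `t`). [folklore] -/
theorem cauchy_uniform_of_pairMatching (hl₀ : 0 ≤ l₀)
    (h : ∀ K K' : ℕ, K ≤ K' → ∃ c : ℝ, ∀ t : ℝ, |t| ≤ l₀ → |Real.log (Z K' t) - Real.log (Z K t) - c| ≤ vol * D K)
    (hD : Tendsto D atTop (𝓝 0)) {ε : ℝ} (hε : 0 < ε) :
    ∃ N : ℕ, ∀ K K' : ℕ, N ≤ K → K ≤ K' → ∀ t : ℝ, |t| ≤ l₀ → |genFun Z K' t - genFun Z K t| < ε := by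
  have h2 : Tendsto (fun K => 2 * (vol * D K)) atTop (𝓝 0) := by
    simpa using (hD.const_mul vol).const_mul 2
  obtain ⟨N, hN⟩ := (Metric.tendsto_atTop.1 h2) ε hε
  refine ⟨N, fun K K' hK hKK' t ht => ?_⟩
  obtain ⟨c, hc⟩ := h K K' hKK'
  have hb := abs_genFun_sub_genFun_le_of_pair hl₀ hc ht
  have hKK := hN K hK
  rw [Real.dist_eq, sub_zero] at hKK
  exact lt_of_le_of_lt (hb.trans (le_abs_self _)) hKK

end Pair

/-! ### By-name exits to nodes U6 and U0 -/

section Exits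

open Missing T4Continuum T4Assembly

variable {G : Type*} [GaugeGroup G] [MeasurableSpace G] {O : Type*}

/-- **NODE U6 FROM PAIR MATCHING.**  Per string `os`: a volume `vol`, a remainder `D → 0`, and the pairwise matching of
the dressed partition functions `T4GenFunBounds.schemeZ S os` for all `K ≤ K′` ⟹ `T4Assembly.GenFunCauchy S l₀`
(node U6's output, by name). [folklore] -/
theorem genFunCauchy_of_pairMatching [HaarData G] (S : TorusScheme G O) {l₀ : ℝ} (hl₀ : 0 ≤ l₀)
    (h : ∀ os : List O, ∃ (vol : ℝ) (D : ℕ → ℝ), Tendsto D atTop (𝓝 0) ∧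
      ∀ K K' : ℕ, K ≤ K' → ∃ c : ℝ, ∀ t : ℝ, |t| ≤ l₀ →
        |Real.log (T4GenFunBounds.schemeZ S os K' t) - Real.log (T4GenFunBounds.schemeZ S os K t) - c| ≤ vol * D K) :
    GenFunCauchy S l₀ := by
  intro os t ht
  obtain ⟨vol, D, hD, hpair⟩ := h os
  exact cauchySeq_genFun_of_pairMatching hl₀ hpair hD ht

variable [RegularGaugeGroup G] [HaarData G]

/-- **NODE U0 FROM PAIR MATCHING**: the continuum limit EXISTS along the full sequence (`Missing.HasContinuumLimit`),
for a scheme of measurable observables bounded by `1` with `β_K ≥ 0`, `0 < l₀`. [folklore] -/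
theorem hasContinuumLimit_of_pairMatching (S : TorusScheme G O) (hβ : ∀ K, 0 ≤ S.β K)
    (hm : ∀ K o, Measurable (S.obs K o)) (h1 : ∀ K o U, |S.obs K o U| ≤ 1) {l₀ : ℝ} (hl₀ : 0 < l₀)
    (h : ∀ os : List O, ∃ (vol : ℝ) (D : ℕ → ℝ), Tendsto D atTop (𝓝 0) ∧
      ∀ K K' : ℕ, K ≤ K' → ∃ c : ℝ, ∀ t : ℝ, |t| ≤ l₀ →
        |Real.log (T4GenFunBounds.schemeZ S os K' t) - Real.log (T4GenFunBounds.schemeZ S os K t) - c| ≤ vol * D K) :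
    HasContinuumLimit S :=
  hasContinuumLimit_of_genFunCauchy S hβ hm h1 hl₀ (genFunCauchy_of_pairMatching S hl₀.le h)

/-- … and any two subsequential limit functionals AGREE (`T4Continuum.LimitPointsAgree`). [folklore] -/
theorem limitPointsAgree_of_pairMatching (S : TorusScheme G O) (hβ : ∀ K, 0 ≤ S.β K)
    (hm : ∀ K o, Measurable (S.obs K o)) (h1 : ∀ K o U, |S.obs K o U| ≤ 1) {l₀ : ℝ} (hl₀ : 0 < l₀)
    (h : ∀ os : List O, ∃ (vol : ℝ) (D : ℕ → ℝ), Tendsto D atTop (𝓝 0) ∧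
      ∀ K K' : ℕ, K ≤ K' → ∃ c : ℝ, ∀ t : ℝ, |t| ≤ l₀ →
        |Real.log (T4GenFunBounds.schemeZ S os K' t) - Real.log (T4GenFunBounds.schemeZ S os K t) - c| ≤ vol * D K) :
    LimitPointsAgree S :=
  limitPointsAgree_of_genFunCauchy S hβ hm h1 hl₀ (genFunCauchy_of_pairMatching S hl₀.le h)

end Exits

/-! ## §2 The hybrid good∕bad-class split is already pairwise -/

section Hybrid

variable {ι : Type*} [DecidableEq ι] {vol l₀ : ℝ}

/-- `hybridDelta vol D W K → 0` when `D K → 0` and `W K → 0` (continuity of `log` at `1`). [folklore] -/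
theorem tendsto_hybridDelta_zero (vol : ℝ) {D W : ℕ → ℝ} (hD : Tendsto D atTop (𝓝 0))
    (hW : Tendsto W atTop (𝓝 0)) : Tendsto (hybridDelta vol D W) atTop (𝓝 0) := by
  have hlog : Tendsto (fun K => Real.log (1 - W K)) atTop (𝓝 0) := by
    have h1 : Tendsto (fun K => 1 - W K) atTop (𝓝 1) := by simpa using hW.const_sub 1
    have := (Real.continuousAt_log one_ne_zero).tendsto.comp h1
    rw [Real.log_one] at this
    exact this
  have : Tendsto (fun K => D K + -Real.log (1 - W K) / vol) atTop (𝓝 (0 + -0 / vol)) :=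
    hD.add (hlog.neg.div_const vol)
  rw [neg_zero, zero_div, add_zero] at this
  have e : hybridDelta vol D W = fun K => D K + -Real.log (1 - W K) / vol := by
    funext K
    rfl
  rw [e]
  exact this

/-- **PAIR MATCHING FROM A PAIRWISE HYBRID SANDWICH.**  Per pair `K ≤ K′` and `|t| ≤ l₀`: run `K`'s terms `A K t` on its
labels `T K`, run `K′`'s terms fibre-summed onto the same labels `B K K′ t` (node U5a's transport iterated `K′ − K + 1`
times — a dictionary, hypothesis `hZB`), a good class on which the terms are sandwiched with radius `vol·D K` modulo a
`t`-independent constant, and bad classes of relative weight `≤ W K < 1` in both runs — ONE CALL of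
`HybridSandwich.abs_log_sum_sub_le` per pair gives the pair bound with remainder `vol·hybridDelta vol D W K`.
[folklore] -/
theorem pairMatching_of_hybridSandwich (hvol : 0 < vol) {T : ℕ → Finset ι} {A : ℕ → ℝ → ι → ℝ}
    {B : ℕ → ℕ → ℝ → ι → ℝ} {Gd : ℕ → ℕ → ℝ → Finset ι} {D W : ℕ → ℝ} {Z : ℕ → ℝ → ℝ}
    (hZA : ∀ (K : ℕ) (t : ℝ), |t| ≤ l₀ → Z K t = ∑ τ ∈ T K, A K t τ)
    (hZB : ∀ (K K' : ℕ) (t : ℝ), K ≤ K' → |t| ≤ l₀ → Z K' t = ∑ τ ∈ T K, B K K' t τ)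
    (hpos : ∀ (K : ℕ) (t : ℝ), |t| ≤ l₀ → 0 < ∑ τ ∈ T K, A K t τ) (hW1 : ∀ K, W K < 1)
    (hhyb : ∀ K K' : ℕ, K ≤ K' → ∃ c : ℝ, ∀ t : ℝ, |t| ≤ l₀ →
      HybridSandwich (T K) (Gd K K' t) (A K t) (B K K' t) c (vol * D K) (W K)) :
    ∀ K K' : ℕ, K ≤ K' → ∃ c : ℝ, ∀ t : ℝ, |t| ≤ l₀ →
      |Real.log (Z K' t) - Real.log (Z K t) - c| ≤ vol * hybridDelta vol D W K := by
  intro K K' hKK'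
  obtain ⟨c, hc⟩ := hhyb K K' hKK'
  refine ⟨c, fun t ht => ?_⟩
  rw [hZA K t ht, hZB K K' t hKK' ht, T4HybridMatching.mul_hybridDelta hvol.ne']
  exact (hc t ht).abs_log_sum_sub_le (hW1 K) (hpos K t ht)

end Hybrid

section HybridExit

open Missing T4Continuum T4Assembly

variable {G : Type*} [GaugeGroup G] [MeasurableSpace G] [HaarData G] {O : Type*}

/-- **NODE U6 FROM A PAIRWISE HYBRID WITH VANISHING DATA.**  Per string: labels, terms, good classes as in
`pairMatching_of_hybridSandwich` for `Z = schemeZ S os`, with `D → 0` (pair discrepancy of the good terms) and `W → 0`,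
`W < 1` (bad-class weights) ⟹ `GenFunCauchy S l₀`.  Rows NE7b∕NE7c enter through `W → 0` ONLY. [folklore] -/
theorem genFunCauchy_of_pairHybrid {ι : Type*} [DecidableEq ι] (S : TorusScheme G O) {l₀ : ℝ} (hl₀ : 0 ≤ l₀)
    (h : ∀ os : List O, ∃ (vol : ℝ) (T : ℕ → Finset ι) (A : ℕ → ℝ → ι → ℝ) (B : ℕ → ℕ → ℝ → ι → ℝ)
      (Gd : ℕ → ℕ → ℝ → Finset ι) (D W : ℕ → ℝ), 0 < vol ∧ Tendsto D atTop (𝓝 0) ∧ Tendsto W atTop (𝓝 0) ∧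
      (∀ K, W K < 1) ∧
      (∀ (K : ℕ) (t : ℝ), |t| ≤ l₀ → T4GenFunBounds.schemeZ S os K t = ∑ τ ∈ T K, A K t τ) ∧
      (∀ (K K' : ℕ) (t : ℝ), K ≤ K' → |t| ≤ l₀ → T4GenFunBounds.schemeZ S os K' t = ∑ τ ∈ T K, B K K' t τ) ∧
      (∀ (K : ℕ) (t : ℝ), |t| ≤ l₀ → 0 < ∑ τ ∈ T K, A K t τ) ∧
      (∀ K K' : ℕ, K ≤ K' → ∃ c : ℝ, ∀ t : ℝ, |t| ≤ l₀ →
        HybridSandwich (T K) (Gd K K' t) (A K t) (B K K' t) c (vol * D K) (W K))) :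
    GenFunCauchy S l₀ := by
  refine genFunCauchy_of_pairMatching S hl₀ fun os => ?_
  obtain ⟨vol, T, A, B, Gd, D, W, hvol, hD, hW, hW1, hZA, hZB, hpos, hhyb⟩ := h os
  exact ⟨vol, hybridDelta vol D W, tendsto_hybridDelta_zero vol hD hW,
    pairMatching_of_hybridSandwich hvol hZA hZB hpos hW1 hhyb⟩

end HybridExit

/-! ## §3 The rate-free crossover: one-run sizes against two-run moduli, by Tannery's theorem -/

section Crossover

/-- **THE RATE-FREE CROSSOVER.**  One-run SIZES `S m ≥ 0` of the terms born at block scale `m`, SUMMABLE over `m`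
(uniformly in the number of steps — the printed type), and two-run MODULI `ω a ≥ 0` depending on the AGE `a = K − m` of
the block scale and merely TENDING TO ZERO: the pair discrepancy `Σ_{m ≤ K} min (S m) (ω (K − m))` TENDS TO ZERO as
`K → ∞`.  Dominated convergence for series (Tannery): each summand tends to `0` (its age grows) and is dominated by the
summable `S`.  No rate on `ω`, no summability in `K`. [folklore] -/
theorem tendsto_sum_min_size_modulus {S ω : ℕ → ℝ} (hS0 : ∀ m, 0 ≤ S m) (hS : Summable S) (hω0 : ∀ a, 0 ≤ ω a)
    (hω : Tendsto ω atTop (𝓝 0)) :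
    Tendsto (fun K => ∑ m ∈ range (K + 1), min (S m) (ω (K - m))) atTop (𝓝 0) := by
  -- extend the summand by zero beyond `m ≤ K` and apply Tannery
  let f : ℕ → ℕ → ℝ := fun K m => if m ≤ K then min (S m) (ω (K - m)) else 0
  have hf_eq : ∀ K, ∑ m ∈ range (K + 1), min (S m) (ω (K - m)) = ∑' m, f K m := by
    intro K
    rw [tsum_eq_sum (s := range (K + 1))]
    · refine sum_congr rfl fun m hm => ?_
      simp only [f, if_pos (Nat.lt_succ_iff.1 (mem_range.1 hm))]
    · intro m hm
      simp only [f, if_neg (fun h => hm (mem_range.2 (Nat.lt_succ_iff.2 h)))]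
  have hlim : ∀ m, Tendsto (fun K => f K m) atTop (𝓝 0) := by
    intro m
    have hωm : Tendsto (fun K => ω (K - m)) atTop (𝓝 0) := hω.comp (tendsto_sub_atTop_nat m)
    refine squeeze_zero' (Eventually.of_forall fun K => ?_) ?_ hωm
    · by_cases h : m ≤ K
      · simp only [f, if_pos h]; exact le_min (hS0 m) (hω0 _)
      · simp only [f, if_neg h]; exact le_rfl
    · filter_upwards [eventually_ge_atTop m] with K hK
      simp only [f, if_pos hK]
      exact min_le_right _ _
  have hbd : ∀ᶠ K in atTop, ∀ m, ‖f K m‖ ≤ S m := Eventually.of_forall fun K m => by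
    by_cases h : m ≤ K
    · simp only [f, if_pos h, Real.norm_eq_abs, abs_of_nonneg (le_min (hS0 m) (hω0 _))]
      exact min_le_left _ _
    · simp only [f, if_neg h, norm_zero]; exact hS0 m
  have h := tendsto_tsum_of_dominated_convergence hS hlim hbd
  simp only [tsum_zero] at h
  exact h.congr fun K => (hf_eq K).symm

/-- The elementary two-piece bound behind it (for the record and for explicit `ε`-bookkeeping): for every `M ≤ K`,
`Σ_{m ≤ K} min (S m) (ω (K − m)) ≤ Σ_{m ≤ M} ω (K − m) + Σ_{M < m ≤ K} S m` — old block scales by the modulus, young ones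
by the size. [folklore] -/
theorem sum_min_size_modulus_le_split (S ω : ℕ → ℝ) {M K : ℕ} (hMK : M ≤ K) :
    ∑ m ∈ range (K + 1), min (S m) (ω (K - m))
      ≤ ∑ m ∈ range (M + 1), ω (K - m) + ∑ m ∈ Ico (M + 1) (K + 1), S m := by
  have hsplit : range (K + 1) = range (M + 1) ∪ Ico (M + 1) (K + 1) := by
    ext m
    simp only [mem_union, mem_range, mem_Ico]
    omega
  have hdisj : Disjoint (range (M + 1)) (Ico (M + 1) (K + 1)) := by
    rw [disjoint_left]
    intro m hm hm'
    rw [mem_range] at hm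
    rw [mem_Ico] at hm'
    omega
  rw [hsplit, sum_union hdisj]
  gcongr with m hm m hm
  · exact min_le_right _ _
  · exact min_le_left _ _

/-- **THE ONE-SIDED KIND.**  The `K′ − K` top steps of the longer run have no partner; if their terms cost at most their
one-run sizes, the total is at most the TAIL `Σ_{m > K} S m` (as a `tsum` over the shifted index), which tends to `0`
— uniformly in `K′`. [folklore] -/
theorem tendsto_onesided_tail (S : ℕ → ℝ) :
    Tendsto (fun K => ∑' m, S (m + (K + 1))) atTop (𝓝 0) :=
  (tendsto_sum_nat_add S).comp (tendsto_add_atTop_nat 1)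

/-- The partial sums over the unmatched top scales `K < m ≤ K′` (written `Ico (K+1) (K′+1)`) are below that tail
(nonnegative summable sizes). [folklore] -/
theorem sum_unmatched_le_tail {S : ℕ → ℝ} (hS0 : ∀ m, 0 ≤ S m) (hS : Summable S) (K K' : ℕ) :
    ∑ m ∈ Ico (K + 1) (K' + 1), S m ≤ ∑' m, S (m + (K + 1)) := by
  have hs : Summable fun m => S (m + (K + 1)) := (summable_nat_add_iff (K + 1)).2 hS
  have e : ∑ m ∈ Ico (K + 1) (K' + 1), S m = ∑ i ∈ range (K' + 1 - (K + 1)), S (i + (K + 1)) := by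
    rw [sum_Ico_eq_sum_range]
    exact sum_congr rfl fun i _ => by rw [add_comm (K + 1) i]
  rw [e]
  exact hs.sum_le_tsum _ fun i _ => hS0 _

end Crossover

/-! ## §4 The contrast: consecutive remainders tending to zero do not give a Cauchy sequence -/

section Contrast

/-- With `Z K t := exp (t · H_K)`, `H_K = Σ_{i<K} 1∕(i+1)` the harmonic numbers, CONSECUTIVE runs match modulo constants
with `δ K = 1∕(K+1) → 0` (`vol = 1`, `l₀ = 1`), yet `K ↦ genFun Z K 1 = H_K` is NOT a Cauchy sequence.  So the
consecutive node U5 genuinely needs `Summable δ`, while the PAIRWISE organisation of §1 needs only `D → 0`. [folklore] -/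
theorem not_cauchySeq_of_harmonic_steps :
    let Z : ℕ → ℝ → ℝ := fun K t => Real.exp (t * ∑ i ∈ range K, (1 : ℝ) / (i + 1))
    T4CauchySum.MatchingModConstants 1 1 (fun K => 1 / (K + 1)) Z ∧
      Tendsto (fun K : ℕ => (1 : ℝ) / (K + 1)) atTop (𝓝 0) ∧ ¬ CauchySeq fun K => genFun Z K 1 := by
  intro Z
  refine ⟨?_, tendsto_one_div_add_atTop_nhds_zero_nat, ?_⟩
  · intro K
    refine ⟨0, fun t ht => ?_⟩
    simp only [Z, Real.log_exp, sum_range_succ, sub_zero]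
    rw [abs_le] at ht
    have e : t * (∑ i ∈ range K, (1 : ℝ) / (i + 1) + 1 / (K + 1)) - t * ∑ i ∈ range K, (1 : ℝ) / (i + 1)
        = t * (1 / (K + 1)) := by ring
    rw [e, abs_mul, one_mul]
    have hK : (0 : ℝ) < 1 / (K + 1) := by positivity
    rw [abs_of_pos hK]
    exact mul_le_of_le_one_left hK.le (abs_le.2 ht)
  · intro hc
    have hg : (fun K => genFun Z K 1) = fun K => ∑ i ∈ range K, (1 : ℝ) / (i + 1) := by
      funext K
      simp [genFun, Z]
    rw [hg] at hc
    obtain ⟨l, hl⟩ := cauchySeq_tendsto_of_complete hc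
    exact not_tendsto_nhds_of_tendsto_atTop Real.tendsto_sum_range_one_div_nat_succ_atTop l hl

end Contrast

end Summit.QuantumFields.BalabanUV.T4Continuum.NE7PairwiseCauchy
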